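import Literature.Analysis.FluidPDE.StokesTorusSemigroupDiagonal
import Mathlib.Analysis.Calculus.MeanValue
import Mathlib.Analysis.SpecialFunctions.ExpDeriv
import HarnessLib

/-!
# Analytic-semigroup calculus of a non-negative diagonal operator

Topic `Literature/Analysis/UnboundedOperators`; companion of `DiagonalOperator.lean` (the diagonal
operators `b.diagonalPMap m`, `b.diagonalCLM s` of a Hilbert basis `b`) and of
`Literature/Analysis/FluidPDE/StokesTorusSemigroupDiagonal.lean` (the semigroup frame
`T t = e^{-tA}`, `K t = A^{3/4} e^{-tA}` of `A = b.diagonalPMap m`).  For a Hilbert basis `b` of a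
real Hilbert space `H` and a symbol `m ≥ 0`, `-A = -diag(m)` generates the analytic semigroup
`e^{-tA} = diag(e^{-tm})`, and the fractional smoothing families `A^α e^{-tA} = diag(m^α e^{-tm})`
(`α ≥ 0`, `t > 0`) are bounded by `(α/e)^α t^{-α}`, differentiable on `(0, ∞)` **in operator norm**
with `d/dt (A^α e^{-tA}) = -A^{α+1} e^{-tA}`, hence norm-continuous there, and map `H` into `D(A)`
with `A (A^α e^{-tA} y) = A^{α+1} e^{-tA} y` (Henry 1981, Thm. 1.3.4 and Thm. 1.4.3; Pazy 1983,
Thm. 2.6.13; Engel–Nagel 2006, Ch. II §4 a) for multiplication semigroups).  Everything is diagonal: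
the proofs are scalar estimates on the symbols (`|e^v - 1 - v| ≤ v² e^{|v|}`,
`x^β e^{-tx} ≤ β^β e^{-β} t^{-β}`, and the uniform second-order Taylor bound
`abs_rpow_mul_exp_taylor_le`) transported by the linear calculus `s ↦ b.diagonalCLM s`
(`diagonalCLM_add/sub/smul`, `eq_diagonalCLM_of_forall_basis`).  The families are never defined
but pinned by their action `E s (b i) = m i^α e^{-s m i} b i` on the basis (which determines them):
existence, norm bound, `HasDerivAt`, `ContinuousOn (Ioi 0)` and the domain identity are the
theorems `*_of_basis_rpow_mul_exp_neg`; `exists_diagonalSemigroupCalculus` packages the case used by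
the mild-solution time-regularity theory (`K₁ = A T`, `K₂ = A K`, `‖K₁ t‖ ≤ t⁻¹`,
`‖K₂ t‖ ≤ 2 t^{-7/4}`, `T' = -K₁`, `K' = -K₂`, norm-continuity, `K₁ t = A ∘ T t`).
Theorem-only; nothing is claimed at `t ≤ 0`.  Deliberately NOT here: analyticity in a sector,
general sectorial operators, fractional powers as unbounded operators.

## References

* D. Henry, *Geometric Theory of Semilinear Parabolic Equations*, LNM 840 (Springer, 1981),
  Thm. 1.3.4, Thm. 1.4.3. [Henry1981]
* A. Pazy, *Semigroups of Linear Operators and Applications to PDE* (Springer, 1983), Thm. 2.6.13.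
* K.-J. Engel, R. Nagel, *A Short Course on Operator Semigroups* (Springer, 2006), Ch. I Prop. 3.11,
  Ch. II §4 a).
-/

noncomputable section

open Filter Set
open scoped Topology ENNReal

open Literature.Analysis.FluidPDE

namespace Literature.Analysis.UnboundedOperators

/-! ### Scalar estimates -/

/-- `|e^ξ - 1| ≤ |ξ| e^{|ξ|}` for every real `ξ` (from `ξ ≤ e^ξ - 1 ≤ ξ e^ξ`, both instances of
`1 + x ≤ e^x`). [folklore] -/
theorem abs_exp_sub_one_le_abs_mul_exp_abs (ξ : ℝ) :
    |Real.exp ξ - 1| ≤ |ξ| * Real.exp |ξ| := by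
  have h1 : ξ ≤ Real.exp ξ - 1 := by linarith [Real.add_one_le_exp ξ]
  have h2 : Real.exp ξ - 1 ≤ ξ * Real.exp ξ := by
    have h := mul_le_mul_of_nonneg_right (Real.add_one_le_exp (-ξ)) (Real.exp_pos ξ).le
    rw [← Real.exp_add, neg_add_cancel, Real.exp_zero] at h
    nlinarith [h]
  rcases le_or_gt 0 ξ with hξ | hξ
  · rw [abs_of_nonneg hξ, abs_of_nonneg (le_trans hξ h1)]
    exact h2
  · have h3 : (1 : ℝ) ≤ Real.exp (-ξ) := Real.one_le_exp (by linarith)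
    have h4 : Real.exp ξ - 1 ≤ 0 := by
      rw [sub_nonpos, Real.exp_le_one_iff]
      exact hξ.le
    rw [abs_of_neg hξ, abs_of_nonpos h4]
    nlinarith

/-- The second-order Taylor estimate `|e^v - 1 - v| ≤ v² e^{|v|}` for every real `v` (mean value
inequality for `v ↦ e^v - 1 - v`, whose derivative `e^ξ - 1` is bounded by `|v| e^{|v|}` between
`0` and `v`). [folklore] -/
theorem abs_exp_sub_one_sub_le_sq_mul_exp_abs (v : ℝ) :
    |Real.exp v - 1 - v| ≤ v ^ 2 * Real.exp |v| := by
  have hderiv : ∀ ξ ∈ uIcc 0 v, HasDerivWithinAt (fun ξ => Real.exp ξ - 1 - ξ)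
      (Real.exp ξ - 1) (uIcc 0 v) ξ := fun ξ _ =>
    (((Real.hasDerivAt_exp ξ).sub_const 1).sub (hasDerivAt_id' ξ)).hasDerivWithinAt
  have hbound : ∀ ξ ∈ uIcc 0 v, ‖Real.exp ξ - 1‖ ≤ |v| * Real.exp |v| := fun ξ hξ => by
    have hξv : |ξ| ≤ |v| := by simpa using abs_sub_left_of_mem_uIcc hξ
    rw [Real.norm_eq_abs]
    calc |Real.exp ξ - 1| ≤ |ξ| * Real.exp |ξ| := abs_exp_sub_one_le_abs_mul_exp_abs ξ
      _ ≤ |v| * Real.exp |v| :=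
        mul_le_mul hξv (Real.exp_le_exp.2 hξv) (Real.exp_pos _).le (abs_nonneg v)
  have h := (convex_uIcc 0 v).norm_image_sub_le_of_norm_hasDerivWithin_le hderiv hbound
    left_mem_uIcc right_mem_uIcc
  simp only [Real.exp_zero, sub_self, sub_zero, Real.norm_eq_abs] at h
  calc |Real.exp v - 1 - v| ≤ |v| * Real.exp |v| * |v| := h
    _ = v ^ 2 * Real.exp |v| := by rw [mul_right_comm, ← abs_mul, abs_mul_self, sq]

/-- `u^β e^{-u} ≤ β^β e^{-β}` for `β > 0`, `u ≥ 0`: the function `u^β e^{-u}` is maximal at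
`u = β` (`β log u - u ≤ β log β - β` is `log (u/β) ≤ u/β - 1`). [folklore] -/
theorem rpow_mul_exp_neg_le_rpow_self {β u : ℝ} (hβ : 0 < β) (hu : 0 ≤ u) :
    u ^ β * Real.exp (-u) ≤ β ^ β * Real.exp (-β) := by
  rcases hu.eq_or_lt with rfl | hu
  · rw [Real.zero_rpow hβ.ne', zero_mul]
    positivity
  rw [Real.rpow_def_of_pos hu, Real.rpow_def_of_pos hβ, ← Real.exp_add, ← Real.exp_add,
    Real.exp_le_exp]
  have h := Real.log_le_sub_one_of_pos (div_pos hu hβ)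
  rw [Real.log_div hu.ne' hβ.ne', div_sub_one hβ.ne', le_div_iff₀ hβ] at h
  nlinarith [h]

/-- **Fractional smoothing inequality** `x^β e^{-tx} ≤ β^β e^{-β} t^{-β}` for `β ≥ 0`, `t > 0`,
`x ≥ 0` (the scalar form of `‖A^β e^{-tA}‖ ≤ C_β t^{-β}`, Henry 1981 Thm. 1.4.3, with the sharp
constant `C_β = (β/e)^β`; `0^0 = 1`). [folklore] -/
theorem rpow_mul_exp_neg_mul_le {β t x : ℝ} (hβ : 0 ≤ β) (ht : 0 < t) (hx : 0 ≤ x) :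
    x ^ β * Real.exp (-(t * x)) ≤ β ^ β * Real.exp (-β) * t ^ (-β) := by
  rcases hβ.eq_or_lt with rfl | hβ
  · simp only [neg_zero, Real.rpow_zero, Real.exp_zero, one_mul, mul_one, Real.exp_le_one_iff,
      neg_nonpos]
    exact mul_nonneg ht.le hx
  have h := rpow_mul_exp_neg_le_rpow_self hβ (mul_nonneg ht.le hx)
  rw [Real.mul_rpow ht.le hx] at h
  rw [Real.rpow_neg ht.le, ← div_eq_mul_inv, le_div_iff₀ (Real.rpow_pos_of_pos ht β)]
  calc x ^ β * Real.exp (-(t * x)) * t ^ β = t ^ β * x ^ β * Real.exp (-(t * x)) := by ring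
    _ ≤ β ^ β * Real.exp (-β) := h

/-- **Uniform second-order Taylor bound for the symbols `x^α e^{-tx}`.**  For `α ≥ 0`, `t > 0`,
`|h| ≤ t/2` and `x ≥ 0`,
`|x^α e^{-(t+h)x} - x^α e^{-tx} + h x^{α+1} e^{-tx}| ≤ (α+2)^{α+2} e^{-(α+2)} (t/2)^{-(α+2)} h²`,
uniformly in `x`: the left side is `x^α e^{-tx} |e^{-hx} - 1 + hx| ≤ h² x^{α+2} e^{-(t-|h|)x}`.
[folklore] -/
theorem abs_rpow_mul_exp_taylor_le {α t h x : ℝ} (hα : 0 ≤ α) (ht : 0 < t) (hh : |h| ≤ t / 2)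
    (hx : 0 ≤ x) :
    |x ^ α * Real.exp (-((t + h) * x)) - x ^ α * Real.exp (-(t * x)) +
        h * (x ^ (α + 1) * Real.exp (-(t * x)))| ≤
      (α + 2) ^ (α + 2) * Real.exp (-(α + 2)) * (t / 2) ^ (-(α + 2)) * h ^ 2 := by
  have hxa : 0 ≤ x ^ α := Real.rpow_nonneg hx α
  have hE : 0 < Real.exp (-(t * x)) := Real.exp_pos _
  have hx1 : x ^ (α + 1) = x ^ α * x := Real.rpow_add_one' hx (by linarith)
  have hx2 : x ^ (α + 2) = x ^ α * x ^ 2 := by rw [Real.rpow_add' hx (by linarith), Real.rpow_two]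
  have hfac : x ^ α * Real.exp (-((t + h) * x)) - x ^ α * Real.exp (-(t * x)) +
      h * (x ^ (α + 1) * Real.exp (-(t * x))) =
      x ^ α * Real.exp (-(t * x)) * (Real.exp (-(h * x)) - 1 - -(h * x)) := by
    have : Real.exp (-((t + h) * x)) = Real.exp (-(t * x)) * Real.exp (-(h * x)) := by
      rw [← Real.exp_add]; ring_nf
    rw [this, hx1]
    ring
  rw [hfac, abs_mul, abs_of_nonneg (mul_nonneg hxa hE.le)]
  have htay := abs_exp_sub_one_sub_le_sq_mul_exp_abs (-(h * x))
  rw [abs_neg, abs_mul, abs_of_nonneg hx] at htay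
  -- `x^α e^{-tx} (hx)² e^{|h| x} = h² x^{α+2} e^{-(t-|h|)x} ≤ h² x^{α+2} e^{-(t/2)x}`
  have hexp : Real.exp (-(t * x)) * Real.exp (|h| * x) ≤ Real.exp (-(t / 2 * x)) := by
    rw [← Real.exp_add, Real.exp_le_exp]
    nlinarith
  have hmain := rpow_mul_exp_neg_mul_le (β := α + 2) (by linarith) (half_pos ht) hx
  calc x ^ α * Real.exp (-(t * x)) * |Real.exp (-(h * x)) - 1 - -(h * x)|
      ≤ x ^ α * Real.exp (-(t * x)) * ((-(h * x)) ^ 2 * Real.exp (|h| * x)) :=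
        mul_le_mul_of_nonneg_left htay (mul_nonneg hxa hE.le)
    _ = x ^ (α + 2) * (Real.exp (-(t * x)) * Real.exp (|h| * x)) * h ^ 2 := by
        rw [hx2]
        ring
    _ ≤ x ^ (α + 2) * Real.exp (-(t / 2 * x)) * h ^ 2 :=
        mul_le_mul_of_nonneg_right
          (mul_le_mul_of_nonneg_left hexp (Real.rpow_nonneg hx _)) (sq_nonneg h)
    _ ≤ (α + 2) ^ (α + 2) * Real.exp (-(α + 2)) * (t / 2) ^ (-(α + 2)) * h ^ 2 :=
        mul_le_mul_of_nonneg_right hmain (sq_nonneg h)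

/-! ### Calculus of bounded real diagonal operators: linearity in the symbol -/

section Diagonal

variable {ι H : Type*} [NormedAddCommGroup H] [InnerProductSpace ℝ H] (b : HilbertBasis ι ℝ H)

/-- `diag(s + s') = diag(s) + diag(s')` (the functional calculus `ℓ^∞ → B(H)` is additive;
Halmos, *A Hilbert Space Problem Book*, Problem 61). [folklore] -/
theorem diagonalCLM_add (s s' : lp (fun _ : ι => ℝ) ∞) :
    b.diagonalCLM (s + s') = b.diagonalCLM s + b.diagonalCLM s' := by
  ext x
  apply b.repr.injective
  ext i
  simp only [HilbertBasis.diagonalCLM_apply_repr, lp.coeFn_add, Pi.add_apply,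
    add_apply, map_add, add_mul]

/-- `diag(s - s') = diag(s) - diag(s')`. [folklore] -/
theorem diagonalCLM_sub (s s' : lp (fun _ : ι => ℝ) ∞) :
    b.diagonalCLM (s - s') = b.diagonalCLM s - b.diagonalCLM s' := by
  ext x
  apply b.repr.injective
  ext i
  simp only [HilbertBasis.diagonalCLM_apply_repr, lp.coeFn_sub, Pi.sub_apply,
    sub_apply, map_sub, sub_mul]

/-- `diag(c • s) = c • diag(s)` (the functional calculus `ℓ^∞ → B(H)` is linear). [folklore] -/
theorem diagonalCLM_smul (c : ℝ) (s : lp (fun _ : ι => ℝ) ∞) :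
    b.diagonalCLM (c • s) = c • b.diagonalCLM s := by
  ext x
  apply b.repr.injective
  ext i
  simp only [HilbertBasis.diagonalCLM_apply_repr, lp.coeFn_smul, Pi.smul_apply,
    smul_apply, LinearIsometryEquiv.map_smul, smul_eq_mul, mul_assoc]

/-- A bounded operator acting diagonally on a Hilbert basis, `L (b i) = s i • b i` with a bounded
symbol `s`, IS the bounded diagonal operator `diag(s)` (two bounded operators agreeing on a
Hilbert basis agree, `HilbertBasis.dense_span`). [folklore] -/
theorem eq_diagonalCLM_of_forall_basis {L : H →L[ℝ] H} {s : lp (fun _ : ι => ℝ) ∞}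
    (h : ∀ i, L (b i) = s i • b i) : L = b.diagonalCLM s := by
  refine ContinuousLinearMap.ext_on
    (Submodule.dense_iff_topologicalClosure_eq_top.mpr b.dense_span) ?_
  rintro _ ⟨i, rfl⟩
  rw [h, b.diagonalCLM_basis]

/-! ### The fractional smoothing families `A^α e^{-tA} = diag(m^α e^{-tm})` -/

variable {m : ι → ℝ}

/-- The symbols `m i^α e^{-s m i}` (`s > 0`, `α ≥ 0`, `m ≥ 0`) form a family in `ℓ^∞(ι, ℝ)`
(bounded by `α^α e^{-α} s^{-α}`, `rpow_mul_exp_neg_mul_le`; junk `0` for `s ≤ 0`). [folklore] -/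
theorem exists_lp_rpow_mul_exp_neg (hpos : ∀ i, 0 ≤ m i) {α : ℝ} (hα : 0 ≤ α) :
    ∃ σ : ℝ → lp (fun _ : ι => ℝ) ∞,
      ∀ s i, 0 < s → σ s i = (m i) ^ α * Real.exp (-(s * m i)) := by
  have hbd : ∀ (s : ℝ) i, ‖(if 0 < s then (m i) ^ α * Real.exp (-(s * m i)) else 0)‖ ≤
      (if 0 < s then α ^ α * Real.exp (-α) * s ^ (-α) else 0) := fun s i => by
    split_ifs with hs
    · rw [Real.norm_of_nonneg (mul_nonneg (Real.rpow_nonneg (hpos i) _) (Real.exp_pos _).le)]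
      exact rpow_mul_exp_neg_mul_le hα hs (hpos i)
    · rw [norm_zero]
  obtain ⟨σ, hσ⟩ := exists_lp_infty_coe_eq _ hbd
  exact ⟨σ, fun s i hs => by rw [hσ, if_pos hs]⟩

/-- **Existence of the fractional smoothing family** `A^α e^{-tA} = diag(m^α e^{-tm})` of
`A = diag(m)` (`m ≥ 0`, `α ≥ 0`): bounded operators `E s` with `E s (b i) = m i^α e^{-s m i} • b i`
for `s > 0` (Henry 1981, Thm. 1.4.3). [folklore] -/
theorem exists_clm_basis_rpow_mul_exp_neg (hpos : ∀ i, 0 ≤ m i) {α : ℝ} (hα : 0 ≤ α) :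
    ∃ E : ℝ → H →L[ℝ] H,
      ∀ s i, 0 < s → E s (b i) = ((m i) ^ α * Real.exp (-(s * m i))) • b i := by
  obtain ⟨σ, hσ⟩ := exists_lp_rpow_mul_exp_neg hpos hα
  exact ⟨fun s => b.diagonalCLM (σ s), fun s i hs => by rw [b.diagonalCLM_basis, hσ s i hs]⟩

/-- **The smoothing estimate `‖A^α e^{-tA}‖ ≤ (α/e)^α t^{-α}`** for a family pinned on the basis by
`E s (b i) = m i^α e^{-s m i} • b i` (`m ≥ 0`, `α ≥ 0`, `t > 0`) (Henry 1981, Thm. 1.4.3; Pazy 1983,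
Thm. 2.6.13 (c); the constant is `sup_x x^α e^{-x} = (α/e)^α`). [folklore] -/
theorem norm_le_of_basis_rpow_mul_exp_neg (hpos : ∀ i, 0 ≤ m i) {α : ℝ} (hα : 0 ≤ α)
    {E : ℝ → H →L[ℝ] H}
    (hE : ∀ s i, 0 < s → E s (b i) = ((m i) ^ α * Real.exp (-(s * m i))) • b i)
    {t : ℝ} (ht : 0 < t) : ‖E t‖ ≤ α ^ α * Real.exp (-α) * t ^ (-α) := by
  obtain ⟨σ, hσ⟩ := exists_lp_rpow_mul_exp_neg hpos hα
  rw [eq_diagonalCLM_of_forall_basis b (L := E t) fun i => by rw [hE t i ht, hσ t i ht]]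
  refine norm_diagonalCLM_le_of_forall_le b _ (by positivity) fun i => ?_
  rw [hσ t i ht, Real.norm_of_nonneg (mul_nonneg (Real.rpow_nonneg (hpos i) _) (Real.exp_pos _).le)]
  exact rpow_mul_exp_neg_mul_le hα ht (hpos i)

/-- **Operator-norm derivative of the fractional smoothing families**: if `E`, `E'` are pinned on
the basis by `E s (b i) = m i^α e^{-s m i} • b i` and `E' s (b i) = m i^{α+1} e^{-s m i} • b i` for
`s > 0` (`m ≥ 0`, `α ≥ 0`), then `t ↦ E t` is differentiable at every `t > 0` as a map into
`H →L[ℝ] H` with derivative `-E' t`, i.e. `d/dt (A^α e^{-tA}) = -A^{α+1} e^{-tA}` in `B(H)`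
(Henry 1981, Thm. 1.3.4 and Thm. 1.4.3; Pazy 1983, Thm. 2.6.13 (c)–(d)): the Taylor remainder
`E (t+h) - E t + h E' t` is diagonal with symbol of sup norm `≤ M(α, t) h²`
(`abs_rpow_mul_exp_taylor_le`). [cite: Henry1981, Thm. 1.3.4 and Thm. 1.4.3] -/
theorem hasDerivAt_of_basis_rpow_mul_exp_neg (hpos : ∀ i, 0 ≤ m i) {α β : ℝ} (hα : 0 ≤ α)
    (hαβ : α + 1 = β) {E E' : ℝ → H →L[ℝ] H}
    (hE : ∀ s i, 0 < s → E s (b i) = ((m i) ^ α * Real.exp (-(s * m i))) • b i)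
    (hE' : ∀ s i, 0 < s → E' s (b i) = ((m i) ^ β * Real.exp (-(s * m i))) • b i)
    {t : ℝ} (ht : 0 < t) : HasDerivAt E (-(E' t)) t := by
  subst hαβ
  obtain ⟨σ, hσ⟩ := exists_lp_rpow_mul_exp_neg hpos hα
  obtain ⟨σ', hσ'⟩ := exists_lp_rpow_mul_exp_neg hpos (by linarith : 0 ≤ α + 1)
  have hEσ : ∀ s, 0 < s → E s = b.diagonalCLM (σ s) := fun s hs =>
    eq_diagonalCLM_of_forall_basis b fun i => by rw [hE s i hs, hσ s i hs]
  have hE'σ : E' t = b.diagonalCLM (σ' t) :=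
    eq_diagonalCLM_of_forall_basis b fun i => by rw [hE' t i ht, hσ' t i ht]
  -- the explicit diagonal family `D s = diag(σ s)` agrees with `E` near `t`
  suffices hD : HasDerivAt (fun s => b.diagonalCLM (σ s)) (-(E' t)) t by
    refine hD.congr_of_eventuallyEq ?_
    filter_upwards [Ioi_mem_nhds ht] with s hs
    exact hEσ s hs
  rw [hE'σ, hasDerivAt_iff_isLittleO_nhds_zero, Asymptotics.isLittleO_iff]
  intro c hc
  obtain ⟨M, hM, hMb⟩ : ∃ M : ℝ, 0 < M ∧ ∀ h x : ℝ, |h| ≤ t / 2 → 0 ≤ x →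
      |x ^ α * Real.exp (-((t + h) * x)) - x ^ α * Real.exp (-(t * x)) +
        h * (x ^ (α + 1) * Real.exp (-(t * x)))| ≤ M * h ^ 2 :=
    ⟨_, by positivity, fun h x hh hx => abs_rpow_mul_exp_taylor_le hα ht hh hx⟩
  have hδ : 0 < min (t / 2) (c / M) := lt_min (half_pos ht) (div_pos hc hM)
  filter_upwards [Metric.ball_mem_nhds (0 : ℝ) hδ] with h hh
  rw [Metric.mem_ball, dist_zero_right, Real.norm_eq_abs] at hh
  have hh2 : |h| < t / 2 := hh.trans_le (min_le_left _ _)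
  have hhc : |h| < c / M := hh.trans_le (min_le_right _ _)
  have hth : 0 < t + h := by
    have := (abs_lt.1 hh2).1
    linarith
  rw [smul_neg, sub_neg_eq_add, ← diagonalCLM_sub, ← diagonalCLM_smul, ← diagonalCLM_add,
    Real.norm_eq_abs]
  refine norm_diagonalCLM_le_of_forall_le b _ (by positivity) fun i => ?_
  rw [lp.coeFn_add, lp.coeFn_sub, lp.coeFn_smul, Pi.add_apply, Pi.sub_apply, Pi.smul_apply,
    smul_eq_mul, hσ (t + h) i hth, hσ t i ht, hσ' t i ht, Real.norm_eq_abs]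
  calc |(m i) ^ α * Real.exp (-((t + h) * m i)) - (m i) ^ α * Real.exp (-(t * m i)) +
          h * ((m i) ^ (α + 1) * Real.exp (-(t * m i)))|
      ≤ M * h ^ 2 := hMb h (m i) hh2.le (hpos i)
    _ = M * |h| * |h| := by rw [mul_assoc, abs_mul_abs_self, sq]
    _ ≤ c * |h| := by
        refine mul_le_mul_of_nonneg_right ?_ (abs_nonneg h)
        rw [lt_div_iff₀ hM] at hhc
        linarith

/-- **Norm-continuity of the fractional smoothing families on `(0, ∞)`**: a family pinned on the
basis by `E s (b i) = m i^α e^{-s m i} • b i` for `s > 0` (`m ≥ 0`, `α ≥ 0`) is continuous on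
`(0, ∞)` into `H →L[ℝ] H` (it is even differentiable there,
`hasDerivAt_of_basis_rpow_mul_exp_neg`; Henry 1981, Thm. 1.3.4). [folklore] -/
theorem continuousOn_Ioi_of_basis_rpow_mul_exp_neg (hpos : ∀ i, 0 ≤ m i) {α : ℝ} (hα : 0 ≤ α)
    {E : ℝ → H →L[ℝ] H}
    (hE : ∀ s i, 0 < s → E s (b i) = ((m i) ^ α * Real.exp (-(s * m i))) • b i) :
    ContinuousOn E (Ioi 0) := by
  obtain ⟨E', hE'⟩ := exists_clm_basis_rpow_mul_exp_neg b hpos (by linarith : 0 ≤ α + 1)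
  exact fun t ht =>
    (hasDerivAt_of_basis_rpow_mul_exp_neg b hpos hα rfl hE hE' ht).continuousAt.continuousWithinAt

/-- **`A^α e^{-tA}` maps into `D(A)` and `A (A^α e^{-tA} y) = A^{α+1} e^{-tA} y`**: for families
pinned on the basis by `E s (b i) = m i^α e^{-s m i} • b i`, `E' s (b i) = m i^{α+1} e^{-s m i} b i`
(`s > 0`, `m ≥ 0`, `α ≥ 0`) and `t > 0`, every `E t y` lies in the maximal domain of
`A = b.diagonalPMap m` and `A (E t y) = E' t y` (`m (m^α e^{-tm} c) = m^{α+1} e^{-tm} c` in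
coordinates; Henry 1981, Thm. 1.4.3; Pazy 1983, Thm. 2.6.13 (a)–(b)). [folklore] -/
theorem exists_diagonalPMap_apply_eq_of_basis_rpow_mul_exp_neg (hpos : ∀ i, 0 ≤ m i) {α β : ℝ}
    (hα : 0 ≤ α) (hαβ : α + 1 = β) {E E' : ℝ → H →L[ℝ] H}
    (hE : ∀ s i, 0 < s → E s (b i) = ((m i) ^ α * Real.exp (-(s * m i))) • b i)
    (hE' : ∀ s i, 0 < s → E' s (b i) = ((m i) ^ β * Real.exp (-(s * m i))) • b i)
    {t : ℝ} (ht : 0 < t) (y : H) :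
    ∃ hy : E t y ∈ (b.diagonalPMap m).domain, b.diagonalPMap m ⟨E t y, hy⟩ = E' t y := by
  subst hαβ
  obtain ⟨σ, hσ⟩ := exists_lp_rpow_mul_exp_neg hpos hα
  obtain ⟨σ', hσ'⟩ := exists_lp_rpow_mul_exp_neg hpos (by linarith : 0 ≤ α + 1)
  have hEσ : E t = b.diagonalCLM (σ t) :=
    eq_diagonalCLM_of_forall_basis b fun i => by rw [hE t i ht, hσ t i ht]
  have hE'σ : E' t = b.diagonalCLM (σ' t) :=
    eq_diagonalCLM_of_forall_basis b fun i => by rw [hE' t i ht, hσ' t i ht]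
  have hcoord : ∀ i, m i * b.repr (E t y) i = b.repr (E' t y) i := fun i => by
    rw [hEσ, hE'σ, b.diagonalCLM_apply_repr, b.diagonalCLM_apply_repr, hσ t i ht, hσ' t i ht,
      Real.rpow_add_one' (hpos i) (by linarith)]
    ring
  have hy : E t y ∈ (b.diagonalPMap m).domain := by
    rw [HilbertBasis.diagonalPMap_domain, HilbertBasis.mem_diagonalDomain_iff,
      funext hcoord]
    exact lp.memℓp _
  refine ⟨hy, b.repr.injective (lp.ext (funext fun i => ?_))⟩
  rw [HilbertBasis.repr_diagonalPMap_apply]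
  exact hcoord i

/-! ### The package `T' = -A T`, `K' = -A K` for the semigroup frame -/

/-- **Analytic-semigroup calculus of the diagonal semigroup frame.**  Let `b` be a Hilbert basis of
a real Hilbert space `H`, `m ≥ 0` a symbol, `A = b.diagonalPMap m`, and let `T, K : ℝ → (H →L[ℝ] H)`
be ANY families acting on the basis as the semigroup and its `3/4`-smoothing,
`T t (b i) = e^{-t m i} b i` and `K t (b i) = m i^{3/4} e^{-t m i} b i` for `t > 0` (e.g. the frame
of `exists_semigroupFrame_diagonalPMap`).  Then there are families `K₁ = A T` and `K₂ = A K`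
(`K₁ t (b i) = m i e^{-t m i} b i`, `K₂ t (b i) = m i^{7/4} e^{-t m i} b i`, `t > 0`) with
`‖K₁ t‖ ≤ t⁻¹`, `‖K₂ t‖ ≤ 2 t^{-7/4}` (`t > 0`); `T` and `K` are differentiable on `(0, ∞)` IN
OPERATOR NORM with `T' t = -K₁ t`, `K' t = -K₂ t`; `T, K, K₁, K₂` are norm-continuous on `(0, ∞)`;
and `T t y ∈ D(A)` with `A (T t y) = K₁ t y` for all `y ∈ H`, `t > 0` — the analytic-semigroup
calculus `d/dt e^{-tA} = -A e^{-tA}`, `‖A^α e^{-tA}‖ ≤ C_α t^{-α}` (Henry 1981, Thm. 1.3.4 and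
Thm. 1.4.3; Pazy 1983, Thm. 2.6.13) in the diagonal realisation `f(A) = diag(f ∘ m)`.  Nothing is
claimed at `t ≤ 0`. [cite: Henry1981, Thm. 1.3.4 and Thm. 1.4.3] -/
theorem exists_diagonalSemigroupCalculus (b : HilbertBasis ι ℝ H) (m : ι → ℝ)
    (hpos : ∀ i, 0 ≤ m i) (T K : ℝ → H →L[ℝ] H)
    (hT : ∀ t i, 0 < t → T t (b i) = Real.exp (-(t * m i)) • b i)
    (hK : ∀ t i, 0 < t → K t (b i) = ((m i) ^ (3 / 4 : ℝ) * Real.exp (-(t * m i))) • b i) :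
    ∃ K₁ K₂ : ℝ → H →L[ℝ] H,
      (∀ t i, 0 < t → K₁ t (b i) = (m i * Real.exp (-(t * m i))) • b i) ∧
      (∀ t i, 0 < t → K₂ t (b i) = ((m i) ^ (7 / 4 : ℝ) * Real.exp (-(t * m i))) • b i) ∧
      (∀ t, 0 < t → ‖K₁ t‖ ≤ t⁻¹) ∧ (∀ t, 0 < t → ‖K₂ t‖ ≤ 2 * t ^ (-(7 / 4 : ℝ))) ∧
      (∀ t, 0 < t → HasDerivAt T (-(K₁ t)) t) ∧ (∀ t, 0 < t → HasDerivAt K (-(K₂ t)) t) ∧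
      ContinuousOn T (Ioi 0) ∧ ContinuousOn K (Ioi 0) ∧ ContinuousOn K₁ (Ioi 0) ∧
      ContinuousOn K₂ (Ioi 0) ∧
      (∀ t, 0 < t → ∀ y : H, ∃ hy : T t y ∈ (b.diagonalPMap m).domain,
        b.diagonalPMap m ⟨T t y, hy⟩ = K₁ t y) := by
  obtain ⟨K₁, hK₁⟩ := exists_clm_basis_rpow_mul_exp_neg b hpos zero_le_one
  obtain ⟨K₂, hK₂⟩ := exists_clm_basis_rpow_mul_exp_neg b hpos (by norm_num : (0 : ℝ) ≤ 7 / 4)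
  have hT' : ∀ t i, 0 < t → T t (b i) = ((m i) ^ (0 : ℝ) * Real.exp (-(t * m i))) • b i :=
    fun t i ht => by rw [Real.rpow_zero, one_mul, hT t i ht]
  have h34 : (0 : ℝ) ≤ 3 / 4 := by norm_num
  have hdT : ∀ t, 0 < t → HasDerivAt T (-(K₁ t)) t := fun t ht =>
    hasDerivAt_of_basis_rpow_mul_exp_neg b hpos le_rfl (zero_add 1) hT' hK₁ ht
  have hdK : ∀ t, 0 < t → HasDerivAt K (-(K₂ t)) t := fun t ht =>
    hasDerivAt_of_basis_rpow_mul_exp_neg b hpos h34 (by norm_num) hK hK₂ ht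
  refine ⟨K₁, K₂, fun t i ht => by rw [hK₁ t i ht, Real.rpow_one], hK₂, fun t ht => ?_,
    fun t ht => ?_, hdT, hdK, fun t ht => (hdT t ht).continuousAt.continuousWithinAt,
    fun t ht => (hdK t ht).continuousAt.continuousWithinAt,
    continuousOn_Ioi_of_basis_rpow_mul_exp_neg b hpos zero_le_one hK₁,
    continuousOn_Ioi_of_basis_rpow_mul_exp_neg b hpos (by norm_num) hK₂, fun t ht y =>
    exists_diagonalPMap_apply_eq_of_basis_rpow_mul_exp_neg b hpos le_rfl (zero_add 1) hT' hK₁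
      ht y⟩
  · -- `‖K₁ t‖ ≤ 1^1 e^{-1} t^{-1} ≤ t⁻¹`
    refine (norm_le_of_basis_rpow_mul_exp_neg b hpos zero_le_one hK₁ ht).trans ?_
    rw [Real.one_rpow, one_mul, Real.rpow_neg_one]
    exact mul_le_of_le_one_left (inv_nonneg.2 ht.le) (Real.exp_le_one_iff.2 (by norm_num))
  · -- `‖K₂ t‖ ≤ (7/4)^{7/4} e^{-7/4} t^{-7/4} ≤ 2 t^{-7/4}` since `(7/4)^{7/4} ≤ e^{7/4}`
    refine (norm_le_of_basis_rpow_mul_exp_neg b hpos (by norm_num) hK₂ ht).trans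
      (mul_le_mul_of_nonneg_right ?_ (Real.rpow_nonneg ht.le _))
    have he : (7 / 4 : ℝ) ≤ Real.exp 1 := by linarith [Real.add_one_le_exp (1 : ℝ)]
    have h1 : (7 / 4 : ℝ) ^ (7 / 4 : ℝ) ≤ Real.exp (7 / 4) := by
      rw [← Real.exp_one_rpow]
      exact Real.rpow_le_rpow (by norm_num) he (by norm_num)
    calc (7 / 4 : ℝ) ^ (7 / 4 : ℝ) * Real.exp (-(7 / 4)) ≤ Real.exp (7 / 4) * Real.exp (-(7 / 4)) :=
          mul_le_mul_of_nonneg_right h1 (Real.exp_pos _).le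
      _ = 1 := by rw [← Real.exp_add, add_neg_cancel, Real.exp_zero]
      _ ≤ 2 := one_le_two

end Diagonal

end Literature.Analysis.UnboundedOperators
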